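import Literature.NumberTheory.LFunctions.GranvilleSoundararajan2003
import Mathlib.Analysis.Real.Pi.Bounds
import HarnessLib

/-!
# Granville–Soundararajan 2003, §5: Theorem 3 from Theorem 1 and Lemma 2.3

Topic `NumberTheory/LFunctions`.  A. Granville, K. Soundararajan, *Decay of mean values of
multiplicative functions*, Canad. J. Math. 55 (2003), 1191–1230 (arXiv:math/9911246), §5 "Proof of
Theorem 3" (arXiv p. 9).  This file PROVES the deduction of Theorem 3
(`GranvilleSoundararajan2003_theorem3`, the named fact of `GranvilleSoundararajan2003.lean`) from
Theorem 1 (`GranvilleSoundararajan2003_theorem1`, the sharp Halász theorem) and Lemma 2.3, exactly as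
printed:

> We may suppose that `|y₀| ≥ 10`.  Applying Theorem 1 with `T = |y₀|/2 - 1` we get that
> `x⁻¹|∑_{n≤x} f(n)| ≪ (max_{|y| ≤ |y₀|-2} |F(1+iy)|/log x) log(e^{1+γ} log x / max_{|y|≤|y₀|-2}|F(1+iy)|)
>   + 1/(|y₀|+1) + log log x/log x`.                                                        (5.1)
> By the definition of `y₀`, for `|y| ≤ |y₀| - 2`, `|F(1+iy)| ≤ (|F(1+iy)F(1+iy₀)|)^{1/2}`, and
> appealing to Lemma 2.3, this is (with `log x ≫ |β| = |y - y₀| ≥ 2`)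
> `≪ (log x)^{2/π} (log log x)^{2(1-2/π)}`.  Using this bound in (5.1), we obtain the Theorem.

**The range of Lemma 2.3 used in §5.**  Lemma 2.3 is printed for `1/log x ≤ |β| ≤ log x`, while §5
applies it with `β = y₀ - y`, `|y| ≤ |y₀| - 2`, `|y₀| ≤ 2 log x` (Theorem 3 takes `T = log x` in (1.3)),
i.e. with `2 ≤ |β| ≤ 2|y₀| - 2 ≤ 4 log x - 2` — the paper writes "`log x ≫ |β|`".  The printed proof of
Lemma 2.3 (arXiv p. 5) gives every range `|β| ≤ K log x` with an implied constant depending on `K`: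
the upper bound for `|β|` enters only through the error `O(δ|β|)`, `δ = 1/log³ x`, in the short sums
`∑_{z ≤ p ≤ z(1+δ)} |cos(½|β| log p)|/p`.  This file proves the deduction with Lemma 2.3 in the
range `1/log x ≤ |β| ≤ 4 log x` as an EXPLICIT HYPOTHESIS (displayed in the statement; no new named
fact is introduced here — the hypothesis is discharged in the companion files proving Lemma 2.3 from the
prime number theorem with the de la Vallée Poussin error term, `ChebyshevThetaDeLaValleePoussin_holds`):

* `GranvilleSoundararajan2003_theorem3_of :
    GranvilleSoundararajan2003_theorem1 → (Lemma 2.3 for |β| ≤ 4 log x) →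
    GranvilleSoundararajan2003_theorem3`.

## The proof in constants (what is checked below)

Let `ℓ = log x ≥ log 3 > 1`, `Λ = log ℓ`, `b = 1 - 2/π ∈ (1/3, 1/2)`, `S = x⁻¹‖∑_{n≤x} f(n)‖ ≤ 1`,
`R = Λ^{1+2b}/ℓ^b` (the second term of Theorem 3), `C₁` the constant of Theorem 1, `C₂ = max(C₂₃, 1)`
with `C₂₃` the constant of the hypothesis (Lemma 2.3 for `|β| ≤ 4 log x`), `D = √C₂`.  We show `S ≤ C(1/(1+|y₀|) + R)` with
`C = 11 + 6D + 3|C₁|`.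
* `|y₀| < 10`: `S ≤ 1 ≤ 11/(1+|y₀|)`.
* `|y₀| ≥ 10`: then `ℓ ≥ 5`, `Λ ≥ 1`; with `T = |y₀|/2 - 1 ≥ 4`, every `|y| ≤ 2T = |y₀| - 2` has
  `‖F(1+iy)‖² ≤ ‖F(1+iy)‖‖F(1+iy₀)‖ ≤ C₂ ℓ^{4/π} (Λ²)^{2b}` (Lemma 2.3 at `(y, y₀ - y)`, where
  `max(1/|β|, Λ²) = Λ²`), so `max_{|y|≤2T}‖F(1+iy)‖ ≤ D ℓ^{1-b} Λ^{2b}` and `L ≤ L⋆ = D Λ^{2b}/ℓ^b`.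
  - If `L⋆ ≤ 1`: `L(log(e^γ/L) + 12/7) ≤ L⋆(γ + 19/7 + log(1/L⋆))` (from `log t ≤ t - 1`), and
    `log(1/L⋆) ≤ log ℓ^b = bΛ` (as `DΛ^{2b} ≥ 1`), so the main term is `≤ 4 L⋆ Λ = 4DR`; the remainder
    `C₁(1/T + Λ/ℓ)` is `≤ |C₁|(3/(1+|y₀|) + R)` (`1/T = 2/(|y₀|-2) ≤ 3/(1+|y₀|)` for `|y₀| ≥ 8`;
    `Λ/ℓ ≤ Λ^{1+2b}/ℓ^b`).
  - If `L⋆ > 1`: `DR = Λ L⋆ ≥ 1 ≥ S`.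

## References

* A. Granville, K. Soundararajan, *Decay of mean values of multiplicative functions*, Canad. J. Math.
  55 (2003), no. 6, 1191–1230, doi:10.4153/CJM-2003-047-0, arXiv:math/9911246: Theorem 3 (arXiv p. 2),
  Lemma 2.3 and its proof (arXiv p. 5), §5 (arXiv p. 9). [GranvilleSoundararajan2003]
-/

noncomputable section

open Finset Filter Complex

namespace Literature.NumberTheory.LFunctions.GranvilleSoundararajan

/-! ### Elementary lemmas for §5 -/

/-- The trivial bound `x⁻¹ ‖∑_{n ≤ x} f(n)‖ ≤ 1` for `|f| ≤ 1`, `x > 0`. [folklore] -/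
theorem norm_sum_Icc_div_le_one {f : ℕ → ℂ} (hf : ∀ n, ‖f n‖ ≤ 1) {x : ℝ} (hx : 0 < x) :
    ‖∑ n ∈ Icc 1 ⌊x⌋₊, f n‖ / x ≤ 1 := by
  rw [div_le_one hx]
  calc ‖∑ n ∈ Icc 1 ⌊x⌋₊, f n‖ ≤ ∑ n ∈ Icc 1 ⌊x⌋₊, ‖f n‖ := norm_sum_le _ _
    _ ≤ ∑ n ∈ Icc 1 ⌊x⌋₊, (1 : ℝ) := Finset.sum_le_sum fun n _ => hf n
    _ = ⌊x⌋₊ := by simp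
    _ ≤ x := Nat.floor_le hx.le

/-- `0 ≤ max_{|y| ≤ 2T} |F(1+iy)| ≤ B` as soon as `|F(1+iy)| ≤ B` on the window (`T ≥ 0`): the
supremum in `maxModulus` is over a nonempty set bounded above. [folklore] -/
theorem maxModulus_nonneg_and_le {g : ℕ → ℂ} (x : ℝ) {T B : ℝ} (hT : 0 ≤ T)
    (hB : ∀ y : ℝ, |y| ≤ 2 * T → ‖truncEulerProduct g x (1 + y * I)‖ ≤ B) :
    0 ≤ maxModulus g x T ∧ maxModulus g x T ≤ B := by
  unfold maxModulus
  set S := (fun y : ℝ => ‖truncEulerProduct g x (1 + y * I)‖) '' Set.Icc (-(2 * T)) (2 * T)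
  have hmem : ∀ y : ℝ, y ∈ Set.Icc (-(2 * T)) (2 * T) → |y| ≤ 2 * T :=
    fun y hy => abs_le.2 ⟨by linarith [hy.1], hy.2⟩
  have h0 : ‖truncEulerProduct g x (1 + (0 : ℝ) * I)‖ ∈ S := ⟨0, ⟨by linarith, by linarith⟩, rfl⟩
  have hne : S.Nonempty := ⟨_, h0⟩
  have hbdd : BddAbove S := ⟨B, by rintro _ ⟨y, hy, rfl⟩; exact hB y (hmem y hy)⟩
  exact ⟨le_csSup_of_le hbdd h0 (norm_nonneg _),
    csSup_le hne (by rintro _ ⟨y, hy, rfl⟩; exact hB y (hmem y hy))⟩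

/-- Monotonicity of the main term of Theorem 1 in the form needed in §5: for `0 ≤ L ≤ L⋆ ≤ 1`,
`L (log(e^γ/L) + 12/7) ≤ L⋆ (γ + 12/7 + 1 + log(1/L⋆))` (from `log t ≤ t - 1` at `t = L⋆/L`).
[folklore] -/
theorem main_term_le {L Ls γ : ℝ} (hγ : 0 ≤ γ) (hL0 : 0 ≤ L) (hL : L ≤ Ls) (hLs1 : Ls ≤ 1) :
    L * (Real.log (Real.exp γ / L) + 12 / 7) ≤ Ls * (γ + 12 / 7 + 1 + Real.log (1 / Ls)) := by
  rcases hL0.eq_or_lt with h | hLpos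
  · -- `L = 0`: the left side vanishes, the right side is nonnegative
    rw [← h, zero_mul]
    have hLs0 : 0 ≤ Ls := h.le.trans hL
    have hlog : 0 ≤ Real.log (1 / Ls) := by
      rcases hLs0.eq_or_lt with h0 | hpos
      · rw [← h0]; simp
      · exact Real.log_nonneg (by rw [le_div_iff₀ hpos]; linarith)
    positivity
  have hLspos : 0 < Ls := hLpos.trans_le hL
  have h1 : Real.log (Real.exp γ / L) = γ - Real.log L := by
    rw [Real.log_div (Real.exp_pos γ).ne' hLpos.ne', Real.log_exp]
  have h2 : -Real.log L = Real.log (Ls / L) + Real.log (1 / Ls) := by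
    rw [Real.log_div hLspos.ne' hLpos.ne', one_div, Real.log_inv]; ring
  have h3 : L * Real.log (Ls / L) ≤ Ls := by
    have := Real.log_le_sub_one_of_pos (div_pos hLspos hLpos)
    calc L * Real.log (Ls / L) ≤ L * (Ls / L - 1) := mul_le_mul_of_nonneg_left this hLpos.le
      _ = Ls - L := by field_simp
      _ ≤ Ls := by linarith
  have h4 : 0 ≤ Real.log (1 / Ls) := Real.log_nonneg (by rw [le_div_iff₀ hLspos]; linarith)
  have h5 : L * Real.log (1 / Ls) ≤ Ls * Real.log (1 / Ls) := mul_le_mul_of_nonneg_right hL h4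
  calc L * (Real.log (Real.exp γ / L) + 12 / 7)
      = L * γ + L * (12 / 7) + (L * Real.log (Ls / L) + L * Real.log (1 / Ls)) := by
        rw [h1, sub_eq_add_neg, h2]; ring
    _ ≤ Ls * γ + Ls * (12 / 7) + (Ls + Ls * Real.log (1 / Ls)) := by
        gcongr
    _ = Ls * (γ + 12 / 7 + 1 + Real.log (1 / Ls)) := by ring

/-! ### §5: Theorem 3 from Theorem 1 and Lemma 2.3 -/

/-- **Granville–Soundararajan 2003, Theorem 3, deduced from Theorem 1 and Lemma 2.3 in the range
`1/log x ≤ |β| ≤ 4 log x`** — the argument of §5 of the paper.  The second hypothesis is Lemma 2.3 of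
the paper ("`|F(1+iy) F(1+i(y+β))| ≪ (log x)^{4/π} max(1/|β|, (log log x)²)^{2(1-2/π)}`", absolute
constant) with the printed range `|β| ≤ log x` replaced by `|β| ≤ 4 log x`, which is what §5 uses
("with `log x ≫ |β| = |y - y₀| ≥ 2`") and what the printed proof of Lemma 2.3 gives.
[cite: GranvilleSoundararajan2003, §5 (Proof of Theorem 3) and Lemma 2.3] -/
theorem GranvilleSoundararajan2003_theorem3_of (h₁ : GranvilleSoundararajan2003_theorem1)
    (h₂₃ : ∃ C : ℝ, ∀ f : ArithmeticFunction ℂ, f.IsMultiplicative → (∀ n, ‖f n‖ ≤ 1) →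
      ∀ x : ℝ, 3 ≤ x → ∀ y β : ℝ, 1 / Real.log x ≤ |β| → |β| ≤ 4 * Real.log x →
        ‖truncEulerProduct f x (1 + y * I) * truncEulerProduct f x (1 + (y + β) * I)‖ ≤
          C * Real.log x ^ (4 / Real.pi) *
            (max (1 / |β|) (Real.log (Real.log x) ^ 2)) ^ (2 * (1 - 2 / Real.pi))) :
    GranvilleSoundararajan2003_theorem3 := by
  obtain ⟨C₁, H1⟩ := h₁
  obtain ⟨C₂₃, H23⟩ := h₂₃
  -- constants
  set C₂ : ℝ := max C₂₃ 1 with hC₂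
  have hC₂1 : 1 ≤ C₂ := le_max_right _ _
  have hC₂0 : 0 ≤ C₂ := by linarith
  set D : ℝ := Real.sqrt C₂ with hD
  have hD1 : 1 ≤ D := Real.one_le_sqrt.mpr hC₂1
  have hC₂le : C₂₃ ≤ C₂ := le_max_left _ _
  have hD0 : 0 ≤ D := by linarith
  have hDsq : D ^ 2 = C₂ := Real.sq_sqrt hC₂0
  have hγlt : Real.eulerMascheroniConstant < 2 / 3 := Real.eulerMascheroniConstant_lt_two_thirds
  have hγpos : 0 < Real.eulerMascheroniConstant := by
    have := Real.one_half_lt_eulerMascheroniConstant; linarith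
  have hπ3 : 3 < Real.pi := Real.pi_gt_three
  have hπ4 : Real.pi < 4 := Real.pi_lt_four
  refine ⟨11 + 6 * D + 3 * |C₁|, fun f hf hfb x hx y₀ hy₀ hmax => ?_⟩
  -- notation and basic ranges
  set b : ℝ := 1 - 2 / Real.pi with hb
  have hb3 : 1 / 3 < b := by
    have : 2 / Real.pi < 2 / 3 := div_lt_div_of_pos_left (by norm_num) (by norm_num) hπ3
    rw [hb]; linarith
  have hb2 : b < 1 / 2 := by
    have : (2 : ℝ) / 4 < 2 / Real.pi := div_lt_div_of_pos_left (by norm_num) Real.pi_pos hπ4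
    rw [hb]; linarith
  have hx0 : 0 < x := by linarith
  set ℓ : ℝ := Real.log x with hℓ
  have hℓ1 : 1 < ℓ := by
    rw [hℓ, ← Real.log_exp 1]
    exact Real.log_lt_log (Real.exp_pos 1) (lt_of_lt_of_le (by have := Real.exp_one_lt_d9; linarith) hx)
  have hℓ0 : 0 < ℓ := by linarith
  set Λ : ℝ := Real.log ℓ with hΛ
  have hΛ0 : 0 < Λ := Real.log_pos hℓ1
  set S : ℝ := ‖∑ n ∈ Icc 1 ⌊x⌋₊, f n‖ / x with hS
  have hS0 : 0 ≤ S := div_nonneg (norm_nonneg _) hx0.le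
  have hS1 : S ≤ 1 := norm_sum_Icc_div_le_one hfb hx0
  set R : ℝ := Λ ^ (1 + 2 * b) / ℓ ^ b with hR
  have hℓb : 0 < ℓ ^ b := Real.rpow_pos_of_pos hℓ0 _
  have hR0 : 0 < R := div_pos (Real.rpow_pos_of_pos hΛ0 _) hℓb
  set a : ℝ := 1 / (1 + |y₀|) with ha
  have ha0 : 0 < a := by rw [ha]; positivity
  have hCD : 0 ≤ 11 + 6 * D + 3 * |C₁| := by positivity
  show S ≤ (11 + 6 * D + 3 * |C₁|) * (a + R)
  by_cases hy10 : |y₀| < 10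
  · -- Case `|y₀| < 10`: trivial bound
    have h11 : 1 ≤ 11 * a := by
      rw [ha, mul_one_div, one_le_div (by positivity)]; linarith
    calc S ≤ 1 := hS1
      _ ≤ 11 * a := h11
      _ ≤ (11 + 6 * D + 3 * |C₁|) * a := by gcongr; linarith [abs_nonneg C₁]
      _ ≤ (11 + 6 * D + 3 * |C₁|) * (a + R) := by gcongr; linarith
  -- Case `|y₀| ≥ 10`
  push Not at hy10
  have hℓ5 : 5 ≤ ℓ := by linarith
  have hΛ1 : 1 ≤ Λ := by
    rw [hΛ, ← Real.log_exp 1]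
    exact Real.log_le_log (Real.exp_pos 1) (le_trans (by have := Real.exp_one_lt_d9; linarith) hℓ5)
  set T : ℝ := |y₀| / 2 - 1 with hT
  have hT4 : 4 ≤ T := by rw [hT]; linarith
  have hT1 : 1 ≤ T := by linarith
  have hT0 : 0 ≤ T := by linarith
  -- the bound on the window `|y| ≤ 2T = |y₀| - 2` from Lemma 2.3
  set B : ℝ := D * ℓ ^ (1 - b) * Λ ^ (2 * b) with hB
  have hB0 : 0 ≤ B := by positivity
  have hBsq : B ^ 2 = C₂ * ℓ ^ (4 / Real.pi) * (Λ ^ 2) ^ (2 * b) := by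
    have e1 : (ℓ ^ (1 - b)) ^ 2 = ℓ ^ (4 / Real.pi) := by
      rw [← Real.rpow_natCast, ← Real.rpow_mul hℓ0.le]; congr 1; rw [hb]; push_cast; ring
    have e2 : (Λ ^ (2 * b)) ^ 2 = (Λ ^ 2) ^ (2 * b) := by
      rw [← Real.rpow_natCast, ← Real.rpow_mul hΛ0.le, show ((2:ℕ):ℝ) = 2 by norm_num,
        show (Λ ^ 2 : ℝ) = Λ ^ (2:ℝ) by rw [← Real.rpow_natCast]; norm_num, ← Real.rpow_mul hΛ0.le]
      congr 1; ring
    calc B ^ 2 = D ^ 2 * (ℓ ^ (1 - b)) ^ 2 * (Λ ^ (2 * b)) ^ 2 := by rw [hB]; ring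
      _ = _ := by rw [hDsq, e1, e2]
  have hwin : ∀ y : ℝ, |y| ≤ 2 * T →
      ‖truncEulerProduct f x (1 + y * I)‖ ≤ B := by
    intro y hy
    have hy' : |y| ≤ |y₀| - 2 := by rw [hT] at hy; linarith
    have hyℓ : |y| ≤ 2 * Real.log x := by linarith
    have hFy := hmax y hyℓ
    -- Lemma 2.3 at `(y, β)`, `β = y₀ - y`
    have hβ2 : 2 ≤ |y₀ - y| := by have := abs_sub_abs_le_abs_sub y₀ y; linarith
    have hβlo : 1 / Real.log x ≤ |y₀ - y| := by
      have : 1 / ℓ ≤ 1 := by rw [div_le_one hℓ0]; linarith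
      linarith
    have hβhi : |y₀ - y| ≤ 4 * Real.log x := by
      obtain ⟨hy1, hy2⟩ := abs_le.1 hy'
      refine abs_le.2 ⟨?_, ?_⟩ <;> linarith [le_abs_self y₀, neg_abs_le y₀]
    have h23 := H23 f hf hfb x hx y (y₀ - y) hβlo hβhi
    have hcast : ((y : ℂ) + ((y₀ - y : ℝ) : ℂ)) = (y₀ : ℂ) := by push_cast; ring
    rw [hcast, norm_mul, ← hℓ] at h23
    have hmaxeq : max (1 / |y₀ - y|) (Real.log (Real.log x) ^ 2) = Λ ^ 2 := by
      refine max_eq_right ?_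
      have h1 : 1 / |y₀ - y| ≤ 1 := by rw [div_le_one (by linarith)]; linarith
      have h2 : (1 : ℝ) ≤ Λ ^ 2 := one_le_pow₀ hΛ1
      exact h1.trans h2
    rw [hmaxeq] at h23
    have hsq : ‖truncEulerProduct f x (1 + y * I)‖ ^ 2 ≤ B ^ 2 := by
      calc ‖truncEulerProduct f x (1 + y * I)‖ ^ 2
          = ‖truncEulerProduct f x (1 + y * I)‖ * ‖truncEulerProduct f x (1 + y * I)‖ := sq _
        _ ≤ ‖truncEulerProduct f x (1 + y * I)‖ * ‖truncEulerProduct f x (1 + y₀ * I)‖ :=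
            mul_le_mul_of_nonneg_left hFy (norm_nonneg _)
        _ ≤ C₂₃ * ℓ ^ (4 / Real.pi) * (Λ ^ 2) ^ (2 * b) := h23
        _ ≤ C₂ * ℓ ^ (4 / Real.pi) * (Λ ^ 2) ^ (2 * b) := by
            have hX : 0 ≤ ℓ ^ (4 / Real.pi) * (Λ ^ 2) ^ (2 * b) :=
              mul_nonneg (Real.rpow_nonneg hℓ0.le _) (Real.rpow_nonneg (sq_nonneg _) _)
            have := mul_le_mul_of_nonneg_right hC₂le hX
            simpa only [mul_assoc] using this
        _ = B ^ 2 := hBsq.symm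
    exact (sq_le_sq₀ (norm_nonneg _) hB0).1 hsq
  obtain ⟨hM0, hMB⟩ := maxModulus_nonneg_and_le (g := f) x hT0 hwin
  -- Theorem 1 with `T = |y₀|/2 - 1`
  have h1 := H1 f hf hfb x T hx hT1
  set M : ℝ := maxModulus f x T with hM
  set L : ℝ := M / ℓ with hL
  set Ls : ℝ := D * Λ ^ (2 * b) / ℓ ^ b with hLs
  have hL0 : 0 ≤ L := div_nonneg hM0 hℓ0.le
  have hLs0 : 0 < Ls := by rw [hLs]; positivity
  have hLLs : L ≤ Ls := by
    rw [hL, hLs, div_le_div_iff₀ hℓ0 hℓb]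
    calc M * ℓ ^ b ≤ B * ℓ ^ b := mul_le_mul_of_nonneg_right hMB hℓb.le
      _ = D * Λ ^ (2 * b) * (ℓ ^ (1 - b) * ℓ ^ b) := by rw [hB]; ring
      _ = D * Λ ^ (2 * b) * ℓ := by
          rw [← Real.rpow_add hℓ0, show (1 - b + b : ℝ) = 1 by ring, Real.rpow_one]
  -- `R = Λ · Λ^{2b} / ℓ^b`, `Λ/ℓ ≤ R`, `1/T ≤ 3a`
  have hRsplit : R = Λ * (Λ ^ (2 * b) / ℓ ^ b) := by
    rw [hR, Real.rpow_add hΛ0, Real.rpow_one]; ring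
  have hDR : D * R = Λ * Ls := by rw [hRsplit, hLs]; ring
  have hΛℓR : Λ / ℓ ≤ R := by
    rw [hR, div_le_div_iff₀ hℓ0 hℓb]
    have h1' : Λ ≤ Λ ^ (1 + 2 * b) := Real.self_le_rpow_of_one_le hΛ1 (by linarith)
    have h2' : ℓ ^ b ≤ ℓ := by
      conv_rhs => rw [← Real.rpow_one ℓ]
      exact Real.rpow_le_rpow_of_exponent_le hℓ1.le (by linarith)
    calc Λ * ℓ ^ b ≤ Λ ^ (1 + 2 * b) * ℓ ^ b := mul_le_mul_of_nonneg_right h1' hℓb.le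
      _ ≤ Λ ^ (1 + 2 * b) * ℓ := mul_le_mul_of_nonneg_left h2' (Real.rpow_nonneg hΛ0.le _)
  have hTa : 1 / T ≤ 3 * a := by
    rw [ha, mul_one_div, div_le_div_iff₀ (by linarith) (by positivity), hT]; linarith
  have hrem : C₁ * (1 / T + Real.log (Real.log x) / Real.log x) ≤ |C₁| * (3 * a + R) := by
    have hnn : 0 ≤ 1 / T + Real.log (Real.log x) / Real.log x := by positivity
    calc C₁ * (1 / T + Real.log (Real.log x) / Real.log x)
        ≤ |C₁| * (1 / T + Real.log (Real.log x) / Real.log x) :=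
          mul_le_mul_of_nonneg_right (le_abs_self _) hnn
      _ ≤ |C₁| * (3 * a + R) := mul_le_mul_of_nonneg_left (add_le_add hTa hΛℓR) (abs_nonneg _)
  by_cases hLs1 : Ls ≤ 1
  · -- main case: `L ≤ L⋆ ≤ 1`
    have hmain := main_term_le hγpos.le hL0 hLLs hLs1
    have hlogLs : Real.log (1 / Ls) ≤ b * Λ := by
      have hDΛ : 1 ≤ D * Λ ^ (2 * b) :=
        one_le_mul_of_one_le_of_one_le hD1 (Real.one_le_rpow hΛ1 (by linarith))
      have h1' : 1 / Ls ≤ ℓ ^ b := by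
        rw [hLs, one_div_div, div_le_iff₀ (by positivity)]
        calc ℓ ^ b = ℓ ^ b * 1 := (mul_one _).symm
          _ ≤ ℓ ^ b * (D * Λ ^ (2 * b)) := mul_le_mul_of_nonneg_left hDΛ hℓb.le
      calc Real.log (1 / Ls) ≤ Real.log (ℓ ^ b) := Real.log_le_log (by positivity) h1'
        _ = b * Λ := by rw [Real.log_rpow hℓ0, hΛ]
    have hmain' : L * (Real.log (Real.exp Real.eulerMascheroniConstant / L) + 12 / 7) ≤ 4 * (D * R) := by
      calc L * (Real.log (Real.exp Real.eulerMascheroniConstant / L) + 12 / 7)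
          ≤ Ls * (Real.eulerMascheroniConstant + 12 / 7 + 1 + Real.log (1 / Ls)) := hmain
        _ ≤ Ls * (4 * Λ) := by
            refine mul_le_mul_of_nonneg_left ?_ hLs0.le
            have hbΛ : b * Λ ≤ (1 / 2) * Λ := mul_le_mul_of_nonneg_right hb2.le hΛ0.le
            linarith
        _ = 4 * (D * R) := by rw [hDR]; ring
    calc S ≤ L * (Real.log (Real.exp Real.eulerMascheroniConstant / L) + 12 / 7)
          + C₁ * (1 / T + Real.log (Real.log x) / Real.log x) := h1
      _ ≤ 4 * (D * R) + |C₁| * (3 * a + R) := add_le_add hmain' hrem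
      _ = (3 * |C₁|) * a + (4 * D + |C₁|) * R := by ring
      _ ≤ (11 + 6 * D + 3 * |C₁|) * a + (11 + 6 * D + 3 * |C₁|) * R := by
          gcongr <;> linarith [abs_nonneg C₁]
      _ = (11 + 6 * D + 3 * |C₁|) * (a + R) := by ring
  · -- `L⋆ > 1`: the right-hand side exceeds `1`
    push Not at hLs1
    have hDR1 : 1 ≤ D * R := by
      rw [hDR]; exact one_le_mul_of_one_le_of_one_le hΛ1 hLs1.le
    calc S ≤ 1 := hS1
      _ ≤ D * R := hDR1
      _ ≤ (11 + 6 * D + 3 * |C₁|) * R := by gcongr; linarith [abs_nonneg C₁]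
      _ ≤ (11 + 6 * D + 3 * |C₁|) * (a + R) := by gcongr; linarith

end Literature.NumberTheory.LFunctions.GranvilleSoundararajan
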